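import Literature.Geometry.Symplectic.JHolomorphicLaplacian
import Literature.Analysis.PDE.HeinzTrick
import HarnessLib

/-!
# The mean value inequality for `J`-holomorphic curves (flat coordinates)

Topic `Literature/Geometry/Symplectic`. McDuff–Salamon (2012), Lemma 4.3.1: there is a
constant `ħ > 0` (depending on bounds for `J`) such that every `J`-holomorphic curve `u` on a
disc `D(z₀, r)` with energy `∫_{D(z₀,r)} |du|² < ħ` satisfies
`|du(z₀)|² ≤ (8 / π r²) ∫_{D(z₀,r)} |du|²`. Here, in the flat vocabulary of
`JHolomorphicMap.lean` / `JHolomorphicLaplacian.lean` (`u : ℂ → G`, `J : G → L(G)`,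
`∂_t u = J(u) ∂_s u`, energy density `e = |∂_s u|² + |∂_t u|²`), with the explicit threshold
`ħ = π / (16 A)`, `A = 2 c₂ + 8 c₁²` for bounds `‖DJ‖ ≤ c₁`, `‖D²J‖ ≤ c₂` on a set containing the
image of the closed disc: the differential inequality `Δe ≥ -A e²`
(`laplacian_energyDensity_ge_of_jHolomorphic`) and the Heinz trick
(`Literature.Analysis.PDE.heinz_trick`, ibid. Lemma 4.3.2).

* `meanValue_of_jHolomorphic` — the theorem.

Everything is proved; no definitions, no named facts.

## References

* D. McDuff, D. Salamon, *J-holomorphic Curves and Symplectic Topology*, 2nd ed., AMS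
  Colloquium Publ. 52 (2012), Lemma 4.3.1, Lemma 4.3.2. [McDuffSalamon2012]
-/

noncomputable section

-- nested operator types `G →L[ℝ] G →L[ℝ] G →L[ℝ] G`
set_option maxSynthPendingDepth 3

open scoped Topology ContDiff Real
open Set Filter Complex MeasureTheory Metric

namespace Literature.Geometry.Symplectic

variable {G : Type*} [NormedAddCommGroup G] [InnerProductSpace ℝ G]

/-- **Mean value inequality for `J`-holomorphic curves** (McDuff–Salamon (2012), Lemma 4.3.1,
flat coordinates, explicit constants). Let `u : ℂ → G` be of class `C³` on an open
`V ⊇ D̄(z₀, r)`, `J`-holomorphic on `V` (`∂_t u = J(u) ∂_s u`, `J(u)² = -1`), for a `J` of class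
`C²` at the points of a set `K ∋ u(D̄(z₀, r))` with `‖DJ‖ ≤ c₁`, `‖D²J‖ ≤ c₂` on `K`. If the energy
`E = ∫_{D(z₀,r)} (|∂_s u|² + |∂_t u|²)` satisfies `16 (2c₂ + 8c₁²) E < π`, then

  `|∂_s u(z₀)|² + |∂_t u(z₀)|² ≤ (8 / (π r²)) E`.

[cite: McDuffSalamon2012, Lemma 4.3.1] -/
theorem meanValue_of_jHolomorphic {J : G → G →L[ℝ] G} {u : ℂ → G} {V : Set ℂ}
    (hV : IsOpen V) (hu : ContDiffOn ℝ 3 u V) {z₀ : ℂ} {r : ℝ} (hr : 0 < r)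
    (hsub : closedBall z₀ r ⊆ V) {K : Set G} (hK : ∀ z ∈ closedBall z₀ r, u z ∈ K)
    (hJ : ∀ x ∈ K, ContDiffAt ℝ 2 J x) {c₁ c₂ : ℝ} (hc₁ : ∀ x ∈ K, ‖fderiv ℝ J x‖ ≤ c₁)
    (hc₂ : ∀ x ∈ K, ‖fderiv ℝ (fderiv ℝ J) x‖ ≤ c₂)
    (hJ2 : ∀ y ∈ V, ∀ v, J (u y) (J (u y) v) = -v)
    (hhol : ∀ y ∈ V, ∀ ζ : ℂ, fderiv ℝ u y (I * ζ) = J (u y) (fderiv ℝ u y ζ))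
    (hE : 16 * (2 * c₂ + 8 * c₁ ^ 2) *
      ∫ z in ball z₀ r, (‖fderiv ℝ u z 1‖ ^ 2 + ‖fderiv ℝ u z I‖ ^ 2) < π) :
    ‖fderiv ℝ u z₀ 1‖ ^ 2 + ‖fderiv ℝ u z₀ I‖ ^ 2 ≤
      8 / (π * r ^ 2) * ∫ z in ball z₀ r, (‖fderiv ℝ u z 1‖ ^ 2 + ‖fderiv ℝ u z I‖ ^ 2) := by
  have hz₀ : z₀ ∈ closedBall z₀ r := mem_closedBall_self hr.le
  have hc₁0 : 0 ≤ c₁ := (norm_nonneg _).trans (hc₁ _ (hK z₀ hz₀))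
  have hc₂0 : 0 ≤ c₂ := (norm_nonneg _).trans (hc₂ _ (hK z₀ hz₀))
  -- the energy density is `C²` on `V`
  have he : ContDiffOn ℝ 2 (fun y ↦ ‖fderiv ℝ u y 1‖ ^ 2 + ‖fderiv ℝ u y I‖ ^ 2) V :=
    ((contDiffOn_fderiv_apply_const_of_contDiffOn hV hu 1).norm_sq ℝ).add
      ((contDiffOn_fderiv_apply_const_of_contDiffOn hV hu I).norm_sq ℝ)
  refine Literature.Analysis.PDE.heinz_trick hV he hr (by positivity) hsub
    (fun z _ ↦ by positivity) (fun z hz ↦ ?_) hE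
  exact laplacian_energyDensity_ge_of_jHolomorphic hV (hsub hz) hu (hJ _ (hK z hz)) hJ2 hhol
    (hc₁ _ (hK z hz)) (hc₂ _ (hK z hz))

end Literature.Geometry.Symplectic

end
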